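import Literature.AlgebraicGeometry.Motives.AbelianVarietyWeilPairingLevel
import Literature.AlgebraicGeometry.Motives.CartierDivisorPullbackLineBundleTrivialization
import Literature.AlgebraicGeometry.RelativeSpec.DiscrepancyInvariantSection
import HarnessLib

/-!
# The Weil pairing `ē_n^Θ(P, Q)` is the inverse of the discrepancy at `t_P` of a trivialisation of `[n]^* 𝒪_A(D_Q)`
# (Mumford §20 p. 184 `e_n(x, L)` = Lang VII §2 / Milne §16 `g / g ∘ t_a`: the character pairing meets the Kummer pairing)

Layer `Literature/AlgebraicGeometry/Motives`, namespace `Literature.AlgebraicGeometry.Motives.AbelianVariety`.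
THEOREMS ONLY (no definition, no named fact, no instance, no notation, no `sorry`).

Setting: `A` an abelian variety over a field `Ω`, `n` with `[n]_A` dominant, `E` a Cartier divisor on `A` (e.g.
`E = D_Q = t_Q^*Θ − Θ`, ★ `weilDiv`), a finite group `K` acting on `A` over `[n]` (`ρ : ActionOver [n] K`, ★
`RelativeSpec/FiniteGroupQuotient`) with `σ_g = t_P` for an `n`-torsion point `P`, and an isomorphism of modules
`e : [n]^* 𝒪_A(E) ≅ [n]^* 𝒪_A` (Mathlib's abstract `Scheme.Modules.pullback`; `𝒪_A(E) = lineBundle E.toUnitCocycle`, ★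
`Modules/LineBundleOfCocycle`) whose DISCREPANCY at `g` against the canonical linearisations (★
`RelativeSpec/PullbackIsoDiscrepancy`: `σ_g^*(e) ≫ can⁰_g = can¹_g ≫ e ≫ (r · 𝟙)`) is a global function `r` with rational
function the constant `c ∈ Ω` ([MumfordAV1970] §20 p. 184: «this isomorphism is multiplication by a root of unity
`e_n(x, L)`»; in the tree `r` is the ★ `TorsionSectionPairing` pairing unit pulled up from the base).

* **`kummerConst_eq_inv_of_discrepancy`** — for every trivializer `h` of `[n]^* E` (★ `IsTrivializer`):
  `kummerConst h P = c⁻¹`, i.e. `t_P^♯ h / h = c⁻¹`.  Proof: `γ := e ≫ ([n]^*𝒪_A → 𝒪_A)` is a trivialisation of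
  `[n]^* 𝒪_A(E)`, whose local equation `H` (★ `CartierDivisor.exists_localEquation_of_pullback_iso_unit`: `H = u_z · [n]^♯ f_{i(z)}`,
  `u_z = γ(η_{[n]} t_z)`) has `H⁻¹` a trivializer of `[n]^* E`; by ★ `functionFieldMap_autHom_eq_of_discrepancy` (the
  pulled-back generator `η_{[n]} t_z` is invariant, hence an `r`-eigen-section) `t_P^♯ u_z = c · u_z`, and `t_P^♯ [n]^♯ f = [n]^♯ f`
  (`t_P ≫ [n] = [n]`), so `t_P^♯ H = c H` and `t_P^♯ H⁻¹ / H⁻¹ = c⁻¹`; finally `kummerConst` does not depend on the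
  trivializer (★ `kummerConst_eq_of_isTrivializer`, Lang VII §2 Prop. 3).
* **`weilPairingLevel_eq_inv_of_discrepancy`** — with `E = D_Q`: `ē_n^Θ(P, Q) = c⁻¹` (★ `weilPairingLevel_eq_kummerConst`).
* `ofSection_appTop_appTop` — the shape of `r` delivered by ★ `AbelianSchemes/TorsionSectionPairing`
  (`r = [n]^♯ π^♯ c₀`, `c₀ ∈ Γ(Spec Ω, 𝒪)`): its rational function is the constant `ΓSpecIso c₀`.

This is the fibre identification (W2) of the cell's hand (h9-S) («symplectic liftability over a connected base from one
geometric point», [Lan2013] Lemma 1.3.6.6 / Cor. 1.3.6.7): it lets the RIGID relative character pairing (★ (W1)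
`TorsionSectionPairing`/`…BaseChange`) transport the Weil pairing between geometric fibres.  Cell `hodgecm-mathlib`
(D-0151), B-plan1 (g15) 04:01:37Z; consumer F-6 (V′).  Count-neutral; HC_CM is proved only modulo the 7 printed citations
until rung 0 closes — nothing here is about HC.

## References
* [MumfordAV1970] D. Mumford, *Abelian Varieties* (1970), §20 (p. 184) (`e_n(x, L)`), §23 (`ē_n`).
* [Lang1983AbelianVarieties] S. Lang, *Abelian Varieties* (1983), Ch. VII §2 Prop. 3.
* [Milne1986AbelianVarieties] J. S. Milne, *Abelian Varieties*, in: Arithmetic Geometry (1986), §16 (p. 132).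
-/

set_option autoImplicit false

noncomputable section

-- `TopCat.Presheaf`/`Scheme.Modules` are not reducible (as in Mathlib's `AlgebraicGeometry/Modules`).
set_option backward.isDefEq.respectTransparency false

universe u

open CategoryTheory Limits AlgebraicGeometry TopologicalSpace Opposite
open Literature.AlgebraicGeometry.Modules Literature.AlgebraicGeometry.RelativeSpec
open Literature.AlgebraicGeometry.RelativeSpec.ActionOver

namespace Literature.AlgebraicGeometry.Motives.AbelianVariety

open RatFn

variable {Ω : Type u} [Field Ω] (A : AbelianVariety Ω)

/-! ## §1 The constant global function `[n]^♯ π^♯ c₀` -/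

/-- **The rational function of the global function `m^♯ π^♯ c₀` is the constant `c₀ ∈ Ω`** (`m` a dominant
`Ω`-endomorphism of `A`, e.g. `[n]`; `π : A → Spec Ω`): the shape in which ★ `AbelianSchemes/TorsionSectionPairing`
delivers its pairing unit. [cite: MumfordAV1970, §20 (p. 184)] -/
theorem ofSection_appTop_appTop {m : A.X.left ⟶ A.X.left} [IsDominant m] (hm : m ≫ A.X.hom = A.X.hom)
    (c₀ : Γ(Spec (.of Ω), ⊤)) :
    ofSection (genericPoint_mem_of_mem (Set.mem_univ (genericPoint A.X.left)) : genericPoint A.X.left ∈ (⊤ : A.X.left.Opens))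
        (m.appTop (A.X.hom.appTop c₀)) =
      algebraMap Ω A.X.left.functionField ((Scheme.ΓSpecIso (.of Ω)).hom c₀) := by
  rw [algebraMap_stalk_apply (X := A.X.left) Ω (genericPoint A.X.left), Iso.hom_inv_id_apply,
    ← CommRingCat.comp_apply, ← Scheme.Hom.comp_appTop, hm]
  rfl

/-! ## §2 The Kummer constant of `[n]^* E` is the inverse discrepancy -/

section Main

variable {n : ℕ} [IsDominant (Hom.toSchemeHom ((n : ℤ) • 𝟙 A))] {K : Type u} [Group K]

/-- **`e_n(P, E) = c⁻¹`: the Kummer constant `t_P^♯ h / h` of ANY trivializer `h` of `[n]^* E` is the inverse of the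
discrepancy constant `c` at `g` (`σ_g = t_P`) of ANY isomorphism `e : [n]^* 𝒪_A(E) ≅ [n]^* 𝒪_A`** against the canonical
linearisations — [MumfordAV1970] §20 p. 184 («`T_x^*(ψ) ∘ ψ⁻¹` is multiplication by `e_n(x, L)`») meets Lang VII §2 /
Milne §16 («`ē_m(a, a′) = g / g ∘ t_a`», up to the inversion `a ↦ −a`).  The morphism `m` is `[n]` (hypothesis `hm`, so
that actions over any syntactic form of `[n]` are accepted); `r ∈ Γ(A, 𝒪_A)` is the discrepancy with rational function
the constant `c` (hypothesis `hr`, cf. `ofSection_appTop_appTop`). [cite: MumfordAV1970, §20 (p. 184)]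
[cite: Lang1983AbelianVarieties, Ch. VII §2 Prop. 3] [cite: Milne1986AbelianVarieties, §16 (p. 132)] -/
theorem kummerConst_eq_inv_of_discrepancy {m : A.X.left ⟶ A.X.left} (hm : m = Hom.toSchemeHom ((n : ℤ) • 𝟙 A))
    (ρ : ActionOver m K) (g : K) (P : A.torsionPoints Ω n) (hg : ρ.autHom g = (A.translation P.1).left)
    (E : CartierDivisor A.X.left)
    (e : (Scheme.Modules.pullback m).obj (Modules.lineBundle E.toUnitCocycle) ≅
      (Scheme.Modules.pullback m).obj (SheafOfModules.unit A.X.left.ringCatSheaf))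
    (r : Γ(A.X.left, ⊤)) (c : Ω)
    (hr : ofSection (genericPoint_mem_of_mem (Set.mem_univ (genericPoint A.X.left)) :
        genericPoint A.X.left ∈ (⊤ : A.X.left.Opens)) r = algebraMap Ω A.X.left.functionField c)
    (he : (Scheme.Modules.pullback (ρ.autHom g)).map e.hom ≫
        ((EquivariantStructure.ofPullback ρ (SheafOfModules.unit A.X.left.ringCatSheaf)).iso g).hom =
      ((EquivariantStructure.ofPullback ρ (Modules.lineBundle E.toUnitCocycle)).iso g).hom ≫ e.hom ≫
        globalScalar ((Scheme.Modules.pullback m).obj (SheafOfModules.unit A.X.left.ringCatSheaf)) r)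
    {h : A.X.left.functionField} (hh : A.IsTrivializer (n := n) E h) :
    kummerConst hh P = c⁻¹ := by
  subst hm
  -- the trivialisation `γ := e ≫ ([n]^* 𝒪 → 𝒪)` of `[n]^* 𝒪(E)` and its local equation `H`; `H⁻¹` trivializes `[n]^* E`
  haveI : IsIso (C := A.X.left.Modules)
      (SheafOfModules.pullbackObjUnitToUnit (Hom.toSchemeHom ((n : ℤ) • 𝟙 A)).toRingCatSheafHom) := by
    haveI := Literature.AlgebraicGeometry.KTheory.final_opensMap (Hom.toSchemeHom ((n : ℤ) • 𝟙 A))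
    exact SheafOfModules.instIsIsoPullbackObjUnitToUnitOfFinal _
  obtain ⟨H, hH0, hHz, -, hHunit⟩ := E.exists_localEquation_of_pullback_iso_unit (Hom.toSchemeHom ((n : ℤ) • 𝟙 A))
    (e ≪≫ asIso (C := A.X.left.Modules)
      (SheafOfModules.pullbackObjUnitToUnit (Hom.toSchemeHom ((n : ℤ) • 𝟙 A)).toRingCatSheafHom))
  have hH : A.IsTrivializer (n := n) E H⁻¹ := ⟨inv_ne_zero hH0, hHunit⟩
  rw [kummerConst_eq_of_isTrivializer hh hH P]
  -- the pulled-back generator `η_{[n]} t_ξ` is an `r`-eigen-section: `t_P^♯ u_ξ = c · u_ξ`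
  have hV := E.genericPoint_mem_preimage_toUnitCocycle_U (Hom.toSchemeHom ((n : ℤ) • 𝟙 A)) (genericPoint A.X.left)
  have key := functionFieldMap_autHom_eq_of_discrepancy ρ (Modules.lineBundle E.toUnitCocycle) e g r he hV
    (E.toUnitCocycle.lineBundleGen (genericPoint A.X.left) (E.toUnitCocycle.U (genericPoint A.X.left)) le_rfl)
  have hHξ : ofSection hV (Scheme.Modules.Hom.app
      (SheafOfModules.pullbackObjUnitToUnit (Hom.toSchemeHom ((n : ℤ) • 𝟙 A)).toRingCatSheafHom) _
        (e.hom.app _ (unitSection (Hom.toSchemeHom ((n : ℤ) • 𝟙 A)) (Modules.lineBundle E.toUnitCocycle)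
          (E.toUnitCocycle.U (genericPoint A.X.left))
          (E.toUnitCocycle.lineBundleGen (genericPoint A.X.left) (E.toUnitCocycle.U (genericPoint A.X.left)) le_rfl)))) *
      functionFieldMap (Hom.toSchemeHom ((n : ℤ) • 𝟙 A)) (E.f (E.chartIdx (genericPoint A.X.left))) = H :=
    hHz (genericPoint A.X.left)
  -- `t_P^♯ [n]^♯ f = [n]^♯ f`
  haveI := isDominant_autHom ρ g
  have hff : ∀ f : A.X.left.functionField, functionFieldMap (ρ.autHom g)
      (functionFieldMap (Hom.toSchemeHom ((n : ℤ) • 𝟙 A)) f) = functionFieldMap (Hom.toSchemeHom ((n : ℤ) • 𝟙 A)) f := by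
    intro f
    rw [← RingHom.comp_apply, ← functionFieldMap_comp]
    have hc : functionFieldMap (ρ.autHom g ≫ Hom.toSchemeHom ((n : ℤ) • 𝟙 A)) =
        functionFieldMap (Hom.toSchemeHom ((n : ℤ) • 𝟙 A)) := by
      congr 1
      exact ρ.autHom_comp g
    rw [hc]
  have htH : functionFieldMap (ρ.autHom g) H = algebraMap Ω A.X.left.functionField c * H := by
    rw [← hHξ, map_mul, key, hff, hr, mul_assoc]
  -- `σ_g = t_P`
  have hFF : functionFieldMap (ρ.autHom g) = A.translFF P.1 := by
    change functionFieldMap (ρ.autHom g) = functionFieldMap (A.translation P.1).left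
    congr 1
  have htr : A.translFF P.1 H = algebraMap Ω A.X.left.functionField c * H := by
    rw [← hFF]; exact htH
  apply (algebraMap Ω A.X.left.functionField).injective
  rw [algebraMap_kummerConst]
  simp only [map_inv₀]
  rw [htr, mul_inv, div_eq_mul_inv, inv_inv, mul_assoc, inv_mul_cancel₀ hH0, mul_one]

/-- **`ē_n^Θ(P, Q) = c⁻¹`** — the level-`n` Weil pairing of the tree (★ `weilPairingLevel`, Lang VII §2 / Milne §16
`g / g ∘ t_a` with `(g) = [n]^{-1}(t_Q^*Θ − Θ)`) is the inverse of the discrepancy constant at `t_P` of any isomorphism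
`e : [n]^* 𝒪_A(D_Q) ≅ [n]^* 𝒪_A` (Mumford's `e_n(P, ·)` read on `L = 𝒪(D_Q)`, [MumfordAV1970] §20 p. 184).
[cite: MumfordAV1970, §20 (p. 184)] [cite: Milne1986AbelianVarieties, §16 (p. 132)] -/
theorem weilPairingLevel_eq_inv_of_discrepancy {m : A.X.left ⟶ A.X.left}
    (hm : m = Hom.toSchemeHom ((n : ℤ) • 𝟙 A)) (ρ : ActionOver m K) (g : K) (Θ : CartierDivisor A.X.left)
    (P Q : A.torsionPoints Ω n) (hg : ρ.autHom g = (A.translation P.1).left)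
    (e : (Scheme.Modules.pullback m).obj (Modules.lineBundle (A.weilDiv Θ Q.1).toUnitCocycle) ≅
      (Scheme.Modules.pullback m).obj (SheafOfModules.unit A.X.left.ringCatSheaf))
    (r : Γ(A.X.left, ⊤)) (c : Ω)
    (hr : ofSection (genericPoint_mem_of_mem (Set.mem_univ (genericPoint A.X.left)) :
        genericPoint A.X.left ∈ (⊤ : A.X.left.Opens)) r = algebraMap Ω A.X.left.functionField c)
    (he : (Scheme.Modules.pullback (ρ.autHom g)).map e.hom ≫
        ((EquivariantStructure.ofPullback ρ (SheafOfModules.unit A.X.left.ringCatSheaf)).iso g).hom =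
      ((EquivariantStructure.ofPullback ρ (Modules.lineBundle (A.weilDiv Θ Q.1).toUnitCocycle)).iso g).hom ≫ e.hom ≫
        globalScalar ((Scheme.Modules.pullback m).obj (SheafOfModules.unit A.X.left.ringCatSheaf)) r) :
    A.weilPairingLevel Θ P Q = c⁻¹ :=
  A.kummerConst_eq_inv_of_discrepancy hm ρ g P hg (A.weilDiv Θ Q.1) e r c hr he (A.isTrivializer_weilFn Θ Q)

end Main

end Literature.AlgebraicGeometry.Motives.AbelianVariety

end
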